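import Summits.ValiantsHypothesis.ValiantsHypothesis.Theorems.KPlusLogSqLawTropicalBPureChainRecords

/-!
# `TropicalB` (stmt-ValiantsHypothesis-19771) — PURE THREE-REGISTER CHAINS, part 1b: the CUT LAW
# (members straddling a cut between the first and the second register number at most `N₁·c + (3(N₂+N₃)+1)·L`)

Helper file for the crux `Theses.KPlusLogSqLaw.TropicalB` (`--supports stmt-ValiantsHypothesis-19771 --as helper`), cell
`pub-symmetroid`, seat val-sym-trop-p2 (g7); continues part 1a (`…TropicalBPureChainRecords`, same hypotheses verbatim).  HONEST
FRAMING: a structure theorem about a SUB-FAMILY of the terms of an ARBITRARY design (a PURE CHAIN of three registers on a common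
window, coupled only through `y < z < w` — the `r = 3` grid family of Gajjar–Radhakrishnan 2018, App. B), inside the Hessenberg
sector where `TropicalB` holds; nothing here bears on `TropicalB` in its window, on `WeakLifting`, on `MatrixDescartes`
(stmt-ValiantsHypothesis-18050) or on VP ≠ VNP.

## Statement (`card_straddle_le`, the CUT LAW)
For every cut `c`, the members `(j,y,k,z,u,w)` with `y < c ≤ z` that are dominant (each at some integer slope, against all present
terms of the design) number at most `N₁·c + (3(N₂+N₃)+1)·L`.

## Proof
A straddling member is a pair (first-register state `x = (j,y)` with `y < c`, configuration `ω = (k,z,u,w)` with `c ≤ z < w`) and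
ANY such pair is feasible, so for two dominant straddling members at slopes `θ < θ'` both part-slopes are non-decreasing and
strictly increase when the part changes (`xc_lt_of_dominant`, `cfg_lt_of_dominant` of part 1a): with the dense ranks of the two
part-slopes the members form a strict chain in the product order, hence `#members ≤ #x + #ω − 1` (`card_le_of_ranks`), and
`#x ≤ N₁·c`, `#ω ≤ (3(N₂+N₃)+1)·L` (`card_configs_le`, part 1a). [folklore-level]
-/

set_option linter.dupNamespace false
set_option autoImplicit false

namespace Summit.ValiantsHypothesis.ValiantsHypothesis.Theorems.KPlusLogSqLaw.PureChain

open Summit.ValiantsHypothesis.ValiantsHypothesis.Theorems.MatrixDescartes.Negative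
open Finset

section Family

variable {m K N₁ N₂ N₃ L : ℕ}
  (d : Fin K → ℕ) (v ε : Fin m → Fin m → Fin K → ℤ)
  (τ : Fin N₁ → Fin L → Fin N₂ → Fin L → Fin N₃ → Fin L → Equiv.Perm (Fin m) × (Fin m → Fin K))
  (s₁ : Fin N₁ → Fin L → ℤ) (s₂ : Fin N₂ → Fin L → ℤ) (s₃ : Fin N₃ → Fin L → ℤ)
  (A₁ : Fin N₁ → Fin L → ℤ) (A₂ : Fin N₂ → Fin L → ℤ) (A₃ : Fin N₃ → Fin L → ℤ)
  (hinj : ∀ j y k z u w j' y' k' z' u' w', y < z → z < w → y' < z' → z' < w' →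
    τ j y k z u w = τ j' y' k' z' u' w' → j = j' ∧ y = y' ∧ k = k' ∧ z = z' ∧ u = u' ∧ w = w')
  (hpres : ∀ j y k z u w, y < z → z < w → termSign ε (τ j y k z u w) ≠ 0)
  (hw : ∀ j y k z u w (θ : ℤ), y < z → z < w →
    tropWeight d v θ (τ j y k z u w) = θ * (s₁ j y + s₂ k z + s₃ u w) - (A₁ j y + A₂ k z + A₃ u w))

open scoped Classical in
include hinj hpres hw in
/-- **THE CUT LAW (first | second register).**  For every cut `c`, the members of a pure three-register chain with `y < c ≤ z`
that are dominant number at most `N₁·c + (3(N₂+N₃)+1)·L`: a monotone staircase in (occurring first-register states left of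
the cut) × (occurring (second, third)-configurations right of it). -/
theorem card_straddle_le (c : ℕ) :
    ((Finset.univ : Finset ((Fin N₁ × Fin L × Fin N₂ × Fin L × Fin N₃ × Fin L))).filter (fun i =>
        i.2.1 < i.2.2.2.1 ∧ i.2.2.2.1 < i.2.2.2.2.2 ∧ (i.2.1 : ℕ) < c ∧ c ≤ (i.2.2.2.1 : ℕ) ∧
        ∃ θ : ℤ, IsDominant d v ε θ (τ i.1 i.2.1 i.2.2.1 i.2.2.2.1 i.2.2.2.2.1 i.2.2.2.2.2))).card ≤
      N₁ * c + (3 * (N₂ + N₃) + 1) * L := by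
  classical
  set S := (Finset.univ : Finset ((Fin N₁ × Fin L × Fin N₂ × Fin L × Fin N₃ × Fin L))).filter (fun i =>
        i.2.1 < i.2.2.2.1 ∧ i.2.2.2.1 < i.2.2.2.2.2 ∧ (i.2.1 : ℕ) < c ∧ c ≤ (i.2.2.2.1 : ℕ) ∧
        ∃ θ : ℤ, IsDominant d v ε θ (τ i.1 i.2.1 i.2.2.1 i.2.2.2.1 i.2.2.2.2.1 i.2.2.2.2.2)) with hSdef
  have hS : ∀ i ∈ S, i.2.1 < i.2.2.2.1 ∧ i.2.2.2.1 < i.2.2.2.2.2 ∧ (i.2.1 : ℕ) < c ∧ c ≤ (i.2.2.2.1 : ℕ) ∧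
      ∃ θ : ℤ, IsDominant d v ε θ (τ i.1 i.2.1 i.2.2.1 i.2.2.2.1 i.2.2.2.2.1 i.2.2.2.2.2) :=
    fun i hi => (Finset.mem_filter.1 hi).2
  -- projections
  let px : (Fin N₁ × Fin L × Fin N₂ × Fin L × Fin N₃ × Fin L) → Fin N₁ × Fin L := fun i => (i.1, i.2.1)
  let pω : (Fin N₁ × Fin L × Fin N₂ × Fin L × Fin N₃ × Fin L) → Fin N₂ × Fin L × Fin N₃ × Fin L := fun i => (i.2.2.1, i.2.2.2.1, i.2.2.2.2.1, i.2.2.2.2.2)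
  set X := S.image px with hX
  set W := S.image pω with hW
  -- slopes of the two parts
  let σx : Fin N₁ × Fin L → ℤ := fun q => s₁ q.1 q.2
  let σω : Fin N₂ × Fin L × Fin N₃ × Fin L → ℤ := fun q => s₂ q.1 q.2.1 + s₃ q.2.2.1 q.2.2.2
  -- the dominance slopes
  have hex : ∀ i ∈ S, ∃ θ : ℤ, IsDominant d v ε θ (τ i.1 i.2.1 i.2.2.1 i.2.2.2.1 i.2.2.2.2.1 i.2.2.2.2.2) :=
    fun i hi => (hS i hi).2.2.2.2
  choose! Θ hΘ using hex
  -- pairwise comparison: for members at slopes θ < θ', both part-slopes are non-decreasing, strictly when the part changes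
  have hcmp : ∀ i ∈ S, ∀ i' ∈ S, Θ i < Θ i' →
      (σx (px i) ≤ σx (px i') ∧ (px i ≠ px i' → σx (px i) < σx (px i'))) ∧
      (σω (pω i) ≤ σω (pω i') ∧ (pω i ≠ pω i' → σω (pω i) < σω (pω i'))) := by
    intro i hi i' hi' hlt
    obtain ⟨hyz, hzw, hyc, hcz, -⟩ := hS i hi
    obtain ⟨hyz', hzw', hyc', hcz', -⟩ := hS i' hi'
    have hd := hΘ i hi
    have hd' := hΘ i' hi'
    refine ⟨?_, ?_⟩
    · by_cases hne : px i = px i'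
      · refine ⟨le_of_eq (by rw [hne]), fun h => absurd hne h⟩
      · have hne1 : ¬ (i.1 = i'.1 ∧ i.2.1 = i'.2.1) := by
          rintro ⟨a, b⟩; exact hne (Prod.ext a b)
        have hne2 : ¬ (i'.1 = i.1 ∧ i'.2.1 = i.2.1) := by
          rintro ⟨a, b⟩; exact hne (Prod.ext a.symm b.symm)
        have h1 := xc_lt_of_dominant d v ε τ s₁ s₂ s₃ A₁ A₂ A₃ hinj hpres hw hyz hzw hyc' hcz hd hne1
        have h2 := xc_lt_of_dominant d v ε τ s₁ s₂ s₃ A₁ A₂ A₃ hinj hpres hw hyz' hzw' hyc hcz' hd' hne2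
        have h3 : σx (px i) < σx (px i') := by
          show s₁ i.1 i.2.1 < s₁ i'.1 i'.2.1
          nlinarith
        exact ⟨le_of_lt h3, fun _ => h3⟩
    · by_cases hne : pω i = pω i'
      · refine ⟨le_of_eq (by rw [hne]), fun h => absurd hne h⟩
      · have hne1 : ¬ (i.2.2.1 = i'.2.2.1 ∧ i.2.2.2.1 = i'.2.2.2.1 ∧ i.2.2.2.2.1 = i'.2.2.2.2.1 ∧
            i.2.2.2.2.2 = i'.2.2.2.2.2) := by
          rintro ⟨a, b, e, f⟩; exact hne (Prod.ext a (Prod.ext b (Prod.ext e f)))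
        have hne2 : ¬ (i'.2.2.1 = i.2.2.1 ∧ i'.2.2.2.1 = i.2.2.2.1 ∧ i'.2.2.2.2.1 = i.2.2.2.2.1 ∧
            i'.2.2.2.2.2 = i.2.2.2.2.2) := by
          rintro ⟨a, b, e, f⟩; exact hne (Prod.ext a.symm (Prod.ext b.symm (Prod.ext e.symm f.symm)))
        have h1 := cfg_lt_of_dominant d v ε τ s₁ s₂ s₃ A₁ A₂ A₃ hinj hpres hw hyz hzw hyc hcz' hzw' hd hne1
        have h2 := cfg_lt_of_dominant d v ε τ s₁ s₂ s₃ A₁ A₂ A₃ hinj hpres hw hyz' hzw' hyc' hcz hzw hd' hne2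
        have h3 : σω (pω i) < σω (pω i') := by
          show s₂ i.2.2.1 i.2.2.2.1 + s₃ i.2.2.2.2.1 i.2.2.2.2.2 < s₂ i'.2.2.1 i'.2.2.2.1 + s₃ i'.2.2.2.2.1 i'.2.2.2.2.2
          nlinarith
        exact ⟨le_of_lt h3, fun _ => h3⟩
  -- distinct members are dominant at distinct slopes
  have hΘne : ∀ i ∈ S, ∀ i' ∈ S, i ≠ i' → Θ i ≠ Θ i' := by
    intro i hi i' hi' hne he
    have h1 := hΘ i hi
    have h2 := hΘ i' hi'
    rw [he] at h1
    obtain ⟨e1, e2, e3, e4, e5, e6⟩ := eq_of_theta_eq d v ε τ s₁ s₂ s₃ A₁ A₂ A₃ hinj hpres hw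
      (hS i hi).1 (hS i hi).2.1 (hS i' hi').1 (hS i' hi').2.1 h1 h2
    exact hne (Prod.ext e1 (Prod.ext e2 (Prod.ext e3 (Prod.ext e4 (Prod.ext e5 e6)))))
  -- dense ranks
  let f : (Fin N₁ × Fin L × Fin N₂ × Fin L × Fin N₃ × Fin L) → ℕ := fun i => (X.filter fun q => σx q < σx (px i)).card
  let g : (Fin N₁ × Fin L × Fin N₂ × Fin L × Fin N₃ × Fin L) → ℕ := fun i => (W.filter fun q => σω q < σω (pω i)).card
  have hfX : ∀ i ∈ S, f i < X.card := by
    intro i hi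
    apply Finset.card_lt_card
    refine (Finset.ssubset_iff_of_subset (Finset.filter_subset _ _)).2 ⟨px i, Finset.mem_image_of_mem _ hi, ?_⟩
    simp
  have hgW : ∀ i ∈ S, g i < W.card := by
    intro i hi
    apply Finset.card_lt_card
    refine (Finset.ssubset_iff_of_subset (Finset.filter_subset _ _)).2 ⟨pω i, Finset.mem_image_of_mem _ hi, ?_⟩
    simp
  -- rank comparison from slope comparison
  have hf_mono : ∀ i i', σx (px i) ≤ σx (px i') → f i ≤ f i' := by
    intro i i' h
    exact Finset.card_le_card (fun q hq => by
      simp only [Finset.mem_filter] at hq ⊢; exact ⟨hq.1, lt_of_lt_of_le hq.2 h⟩)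
  have hf_strict : ∀ i ∈ S, ∀ i', σx (px i) < σx (px i') → f i < f i' := by
    intro i hi i' h
    apply Finset.card_lt_card
    refine (Finset.ssubset_iff_of_subset ?_).2 ⟨px i, ?_, ?_⟩
    · intro q hq; simp only [Finset.mem_filter] at hq ⊢; exact ⟨hq.1, hq.2.trans h⟩
    · simp only [Finset.mem_filter]; exact ⟨Finset.mem_image_of_mem _ hi, h⟩
    · simp
  have hg_mono : ∀ i i', σω (pω i) ≤ σω (pω i') → g i ≤ g i' := by
    intro i i' h
    exact Finset.card_le_card (fun q hq => by
      simp only [Finset.mem_filter] at hq ⊢; exact ⟨hq.1, lt_of_lt_of_le hq.2 h⟩)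
  have hg_strict : ∀ i ∈ S, ∀ i', σω (pω i) < σω (pω i') → g i < g i' := by
    intro i hi i' h
    apply Finset.card_lt_card
    refine (Finset.ssubset_iff_of_subset ?_).2 ⟨pω i, ?_, ?_⟩
    · intro q hq; simp only [Finset.mem_filter] at hq ⊢; exact ⟨hq.1, hq.2.trans h⟩
    · simp only [Finset.mem_filter]; exact ⟨Finset.mem_image_of_mem _ hi, h⟩
    · simp
  -- the staircase count
  have hmain : S.card ≤ X.card + W.card - 1 := by
    refine card_le_of_ranks S f g X.card W.card hfX hgW ?_
    intro a ha b hb hab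
    have hpair : px a ≠ px b ∨ pω a ≠ pω b := by
      by_contra h
      push Not at h
      apply hab
      obtain ⟨h1, h2⟩ := h
      have h1' : (a.1, a.2.1) = (b.1, b.2.1) := h1
      have h2' : (a.2.2.1, a.2.2.2.1, a.2.2.2.2.1, a.2.2.2.2.2) = (b.2.2.1, b.2.2.2.1, b.2.2.2.2.1, b.2.2.2.2.2) := h2
      simp only [Prod.mk.injEq] at h1' h2'
      obtain ⟨e1, e2⟩ := h1'
      obtain ⟨e3, e4, e5, e6⟩ := h2'
      exact Prod.ext e1 (Prod.ext e2 (Prod.ext e3 (Prod.ext e4 (Prod.ext e5 e6))))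
    rcases lt_or_gt_of_ne (hΘne a ha b hb hab) with hlt | hlt
    · left
      obtain ⟨⟨hx1, hx2⟩, ⟨hw1, hw2⟩⟩ := hcmp a ha b hb hlt
      refine ⟨hf_mono a b hx1, hg_mono a b hw1, ?_⟩
      rcases hpair with hp | hp
      · exact Or.inl (hf_strict a ha b (hx2 hp))
      · exact Or.inr (hg_strict a ha b (hw2 hp))
    · right
      obtain ⟨⟨hx1, hx2⟩, ⟨hw1, hw2⟩⟩ := hcmp b hb a ha hlt
      refine ⟨hf_mono b a hx1, hg_mono b a hw1, ?_⟩
      rcases hpair with hp | hp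
      · exact Or.inl (hf_strict b hb a (hx2 (Ne.symm hp)))
      · exact Or.inr (hg_strict b hb a (hw2 (Ne.symm hp)))
  -- the two part counts
  have hXle : X.card ≤ N₁ * c := by
    have hmaps : ∀ q ∈ X, (fun q : Fin N₁ × Fin L => (q.1, (q.2 : ℕ))) q ∈
        (Finset.univ : Finset (Fin N₁)) ×ˢ Finset.range c := by
      intro q hq
      obtain ⟨i, hi, rfl⟩ := Finset.mem_image.1 hq
      simp only [Finset.mem_product, Finset.mem_univ, Finset.mem_range, true_and]
      exact (hS i hi).2.2.1
    have hinjx : Set.InjOn (fun q : Fin N₁ × Fin L => (q.1, (q.2 : ℕ))) ↑X := by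
      intro q _ q' _ h
      simp only [Prod.mk.injEq] at h
      exact Prod.ext h.1 (Fin.ext h.2)
    calc X.card ≤ ((Finset.univ : Finset (Fin N₁)) ×ˢ Finset.range c).card :=
          Finset.card_le_card_of_injOn _ hmaps hinjx
      _ = N₁ * c := by rw [Finset.card_product, Finset.card_univ, Fintype.card_fin, Finset.card_range]
  have hWle : W.card ≤ (3 * (N₂ + N₃) + 1) * L :=
    card_configs_le d v ε τ s₁ s₂ s₃ A₁ A₂ A₃ hinj hpres hw c S hS
  omega

end Family

end Summit.ValiantsHypothesis.ValiantsHypothesis.Theorems.KPlusLogSqLaw.PureChain
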